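import Literature.ModelTheory.FiniteModelTheory.PPGadgetCode
import Literature.Computability.Complexity.CodeFPClosure
import HarnessLib

/-!
# pp-constructibility gives polynomial-time reductions (discharge of
`cspLanguage_karpReducible_of_ppConstructs`)

Topic `Literature/ModelTheory/FiniteModelTheory`. We prove the named fact
`cspLanguage_karpReducible_of_ppConstructs` of `PPInterpretation.lean`: if the finite template `T`
(tables on `Fin m`, vocabulary `ar`) pp-constructs the finite template `T'` (tables on `Fin m'`,
vocabulary `br`, non-degenerate) then `cspLanguage T' ≤ₚ cspLanguage T` — Barto–Opršal–Pinsker,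
*The wonderland of reflections* [BartoOprsalPinsker2017], Cor. 3.5 with Cor. 3.10 (pp-constructible =
homomorphically equivalent to a pp-power) and Prop. 3.1 (the gadget reduction of Bulatov–Jeavons–
Krokhin), Prop. 3.2 (homomorphically equivalent templates have the same CSP). The source states
LOG-SPACE reducibility; the tree has polynomial-time Karp reductions, the weaker consequence, which
is what is proved.

The reduction is the string function `GadgetCode.redFn P`: on a well-formed instance code
(`GadgetCode.instOK`) it parses the universe size `n` and the table string, lists the holding
constraints (`conNum`), expands every listed constraint into its gadget (`edgesN`, `factsN`, the
variables being `d` copies of each element and a fresh block per listed constraint), identifies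
variables along the equality atoms by RELABELLING every variable with the least element of its class
(`MinLabel.minLabels`, `Complexity/CodeFPClosure.lean`) — the universe is not shrunk, non-least
variables stay isolated — and tabulates the result (`bitsN`); ill-formed strings go to the non-code
`ε`. Polynomial time is `GadgetCode.redFn_mem_FP` (the `CodeFP` algebra, `PPGadgetCode.lean`).
Correctness identifies, stage by stage, the numbers computed with the typed gadget system of
`PPGadgetSystem.lean` along the explicit bijection `eV : SysVar ≃ Fin N'`
(`finProdFinEquiv`/`finSigmaFinEquiv`/`finSumFinEquiv`): `conNum_tableString` (the constraint list
read off the code is the code of `conList R`), `val_eV_sysLoc` (placements), `edgesN_eq_map`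
(edges), `getD_labels_eq` (labels are least elements = the representatives `repV`),
`mem_factsN_iff` (facts = tuples of `sysStructure`), `bitsN_eq_ofFn` (the output string is the
table string of the transported structure, via the layout lemma `ofFn_relTablesEquiv_eq_flatMap`),
and then `PPPower.nonempty_sysHom_iff` + `HomEquivalent.nonempty_hom_iff` give
`w ∈ cspLanguage T' ↔ redFn P w ∈ cspLanguage T`.

## References

* L. Barto, J. Opršal, M. Pinsker, *The wonderland of reflections*, Israel J. Math. 223 (2018)
  = arXiv:1510.04521, Prop. 3.1, Prop. 3.2, Cor. 3.5, Def. 3.6, Cor. 3.10. [BartoOprsalPinsker2017]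
* A. Bulatov, P. Jeavons, A. Krokhin, *Classifying the complexity of constraints using finite
  algebras*, SIAM J. Comput. 34 (2005) 720–742 (the gadget reduction cited as Prop. 3.1).
* S. Arora, B. Barak, *Computational Complexity: A Modern Approach*, CUP 2009, §1.3. [AroraBarak2009]
-/

namespace Literature.ModelTheory.FiniteModelTheory

open scoped _root_.FirstOrder
open _root_.FirstOrder.Language (Structure)
open _root_.FirstOrder.Language.Structure (RelMap)
open _root_.Relation _root_.Computability
open Literature.Computability.Complexity Literature.Computability.Complexity.CodeFP
  Literature.Computability.Complexity.Brick Literature.Computability.Cryptography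

namespace GadgetCode

variable {ar br : List ℕ} {d : ℕ} (P : PPPower (relLanguage ar) (relLanguage br) d) {n : ℕ}

/-! ### Generic list lemmas -/

/-- `List.ofFn` of a function of the value is a `map` over `List.range`. [folklore] -/
theorem ofFn_eq_map_range {α : Type*} {k : ℕ} (g : ℕ → α) :
    List.ofFn (fun j : Fin k => g j) = (List.range k).map g := by
  rw [List.ofFn_eq_map, ← List.map_coe_finRange_eq_range, List.map_map]
  rfl

/-- Enumerating a mapped list: `zip [0, …) (C.map f)` is the map `i ↦ (i, f (C i))` over the
positions. [folklore] -/
theorem zip_range_map {α β : Type*} (C : List α) (f : α → β) :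
    (List.range (C.map f).length).zip (C.map f) =
      (List.finRange C.length).map fun i : Fin C.length => (i.val, f (C.get i)) := by
  apply List.ext_getElem
  · simp
  · intro j h₁ h₂
    rw [List.getElem_zip, List.getElem_map]
    simp

/-- A prefix sum of a mapped list as a `Fin`-indexed sum. [folklore] -/
theorem sum_map_take_eq {α : Type*} (C : List α) (f : α → ℕ) {i : ℕ} (hi : i ≤ C.length) :
    ((C.take i).map f).sum = ∑ i' : Fin i, f (C.get (Fin.castLE hi i')) := by
  rw [Fin.sum_univ_def]
  congr 1
  apply List.ext_getElem
  · simp [Nat.min_eq_left hi]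
  · intro j h₁ h₂
    simp

/-- **Indexing into a concatenation of blocks**: position `(lengths of the blocks before block
`i`) + t` of `L.flatMap f` is position `t` of block `i`. [folklore] -/
theorem getElem?_flatMap_blocks {α β : Type*} (f : α → List β) :
    ∀ (L : List α) (i : ℕ) (hi : i < L.length) (t : ℕ), t < (f L[i]).length →
      (L.flatMap f)[((L.take i).map fun a => (f a).length).sum + t]? = (f L[i])[t]?
  | [], i, hi, _, _ => absurd hi (Nat.not_lt_zero _)
  | a :: L, 0, _, t, ht => by
    rw [List.getElem_cons_zero] at ht
    rw [List.flatMap_cons, List.take_zero, List.map_nil, List.sum_nil, Nat.zero_add,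
      List.getElem_cons_zero, List.getElem?_append_left ht]
  | a :: L, i + 1, hi, t, ht => by
    rw [List.getElem_cons_succ] at ht
    rw [List.flatMap_cons, List.take_succ_cons, List.map_cons, List.sum_cons, List.getElem_cons_succ,
      Nat.add_assoc, List.getElem?_append_right (Nat.le_add_right _ _), Nat.add_sub_cancel_left]
    exact getElem?_flatMap_blocks f L i (by simpa using hi) t ht

/-! ### The table string of an instance and the layout lemma -/

/-- The TABLE STRING of the tables `R` (the body of the code `encodingSNPInstance br ⟨n, R⟩`).
[cite: BartoOprsalPinsker2017, §2.2] -/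
abbrev tableString {ar : List ℕ} {n : ℕ} (R : RelTables ar n) : List Bool := List.ofFn (relTablesEquiv ar n R)

/-- The code of an instance is its header numeral paired with its table string. [folklore] -/
theorem encode_eq {ar : List ℕ} (x : SNPInstance ar) :
    (encodingSNPInstance ar).encode x = boolPair (encodeNat x.1) (tableString x.2) := rfl

/-- The table string has `tableBits` bits. [folklore] -/
@[simp] theorem length_tableString {ar : List ℕ} {n : ℕ} (R : RelTables ar n) :
    (tableString R).length = tableBits ar n := List.length_ofFn

/-- Layout of the table string, pointwise: bit `blockOff s + t` is table `s` at the scope numbered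
`t` (Mathlib `finSigmaFinEquiv_apply`). [folklore] -/
theorem getD_tableString {ar : List ℕ} {n : ℕ} (R : RelTables ar n) (s : Fin ar.length)
    (t : Fin (n ^ ar.get s)) :
    (tableString R).getD (blockOff ar n s + t) false = R s (finFunctionFinEquiv.symm t) := by
  let x : Fin (tableBits ar n) := finSigmaFinEquiv ⟨s, t⟩
  have hx : (x : ℕ) = blockOff ar n s + t := by
    rw [blockOff_eq_sum n s s.2.le]
    exact finSigmaFinEquiv_apply _
  rw [← hx, List.getD_eq_getElem _ _ (by simp), List.getElem_ofFn]
  change relTablesEquiv ar n R x = _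
  change R ((finSigmaFinEquiv.symm x : Σ i : Fin ar.length, Fin (n ^ ar.get i))).1
    (finFunctionFinEquiv.symm ((finSigmaFinEquiv.symm x : Σ i : Fin ar.length, Fin (n ^ ar.get i))).2) = _
  have : (finSigmaFinEquiv.symm x : Σ i : Fin ar.length, Fin (n ^ ar.get i)) = ⟨s, t⟩ :=
    Equiv.symm_apply_apply _ _
  rw [this]

/-- **THE LAYOUT LEMMA**: the table string is the concatenation, symbol by symbol, of the tables
listed scope by scope. [folklore] -/
theorem ofFn_relTablesEquiv_eq_flatMap {ar : List ℕ} (N : ℕ) (R' : RelTables ar N) :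
    List.ofFn (relTablesEquiv ar N R') =
      (List.finRange ar.length).flatMap fun r =>
        List.ofFn fun t : Fin (N ^ ar.get r) => R' r (finFunctionFinEquiv.symm t) := by
  apply List.ext_getElem?
  intro j
  by_cases hj : j < tableBits ar N
  · obtain ⟨⟨r, t⟩, hx⟩ := finSigmaFinEquiv.surjective (⟨j, hj⟩ : Fin (tableBits ar N))
    have hjv : j = blockOff ar N r + t := by
      have h := congrArg Fin.val hx
      rw [finSigmaFinEquiv_apply] at h
      rw [blockOff_eq_sum N r r.2.le]
      exact h.symm
    have hL : (List.ofFn (relTablesEquiv ar N R'))[j]? = some (R' r (finFunctionFinEquiv.symm t)) := by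
      rw [List.getElem?_eq_getElem (by simpa using hj), Option.some_inj, ← List.getD_eq_getElem _ false,
        hjv]
      exact getD_tableString R' r t
    have hoff : ((List.finRange ar.length).take r).map
        (fun r' => (List.ofFn fun t : Fin (N ^ ar.get r') => R' r' (finFunctionFinEquiv.symm t)).length) =
        ((List.finRange ar.length).take r).map fun r' => N ^ ar.get r' := by
      simp
    have hR : ((List.finRange ar.length).flatMap fun r =>
        List.ofFn fun t : Fin (N ^ ar.get r) => R' r (finFunctionFinEquiv.symm t))[j]? =
        some (R' r (finFunctionFinEquiv.symm t)) := by
      have h := getElem?_flatMap_blocks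
        (fun r' : Fin ar.length => List.ofFn fun t : Fin (N ^ ar.get r') => R' r' (finFunctionFinEquiv.symm t))
        (List.finRange ar.length) r (by simp) t (by simp)
      rw [hoff, sum_map_take_eq _ _ (by simp : (r : ℕ) ≤ (List.finRange ar.length).length)] at h
      have hsum : ∑ i' : Fin r, N ^ ar.get ((List.finRange ar.length).get (Fin.castLE (by simp) i')) =
          blockOff ar N r := by
        rw [blockOff_eq_sum N r r.2.le]
        refine Finset.sum_congr rfl fun i' _ => ?_
        congr 2
        apply Fin.ext
        simp
      have hr : (List.finRange ar.length)[(r : ℕ)]'(by simp) = r := Fin.ext (by simp)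
      rw [hsum, ← hjv, hr] at h
      rw [h, List.getElem?_eq_getElem (by simp), List.getElem_ofFn]
    rw [hL, hR]
  · rw [List.getElem?_eq_none (by simpa using Nat.not_lt.1 hj), List.getElem?_eq_none]
    rw [List.length_flatMap, Nat.not_lt] at *
    refine le_trans (le_of_eq ?_) hj
    rw [tableBits, Fin.sum_univ_def]
    congr 1
    simp

/-! ### The constraint list read off the table string -/

/-- The numeric form of a constraint: symbol index and scope number. [folklore] -/
def conCode (c : PPPower.Con br n) : ℕ × ℕ := ((c.1 : ℕ), (finFunctionFinEquiv c.2 : ℕ))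

/-- **Reading the constraints off the table string yields the code of `conList R`.** [folklore] -/
theorem conNum_tableString (R : RelTables br n) :
    conNum br n (tableString R) = (PPPower.conList R).map conCode := by
  rw [conNum, PPPower.conList, List.map_flatMap, ← List.map_coe_finRange_eq_range, List.flatMap_map]
  congr 1
  funext s
  rw [List.map_map, conAt, List.getD_eq_getElem _ _ s.2, ← List.map_coe_finRange_eq_range, List.filter_map,
    List.map_map]
  have hfilt : ((List.finRange (n ^ br[(s : ℕ)])).filter
      ((fun t => (tableString R).getD (blockOff br n s + t) false) ∘ fun t : Fin (n ^ br[(s : ℕ)]) => (t : ℕ))) =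
      (List.finRange (n ^ br.get s)).filter fun t => R s (finFunctionFinEquiv.symm t) := by
    change ((List.finRange (n ^ br.get s)).filter _) = _
    refine List.filter_congr fun t _ => ?_
    exact getD_tableString R s t
  rw [hfilt]
  refine List.map_congr_left fun t _ => ?_
  simp [conCode]

/-! ### The number of variables and the bijection with `Fin N'` -/

/-- The number of variables of the gadget system of `C`: `n d + Σᵢ e_{sᵢ}`. [cite: BartoOprsalPinsker2017, Prop. 3.1 (proof)] -/
abbrev Nv (C : List (PPPower.Con br n)) : ℕ := n * d + ∑ i : Fin C.length, P.nEx (C.get i).1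

/-- **The bijection of the variables with `Fin N'`**: copies block by element, then the fresh blocks
in the order of the list. [folklore] -/
def eV (C : List (PPPower.Con br n)) : P.SysVar C ≃ Fin (Nv P C) :=
  (Equiv.sumCongr finProdFinEquiv finSigmaFinEquiv).trans finSumFinEquiv

/-- The number of copy `j` of element `x` is `j + d x`. [folklore] -/
theorem val_eV_inl (C : List (PPPower.Con br n)) (x : Fin n) (j : Fin d) :
    (eV P C (Sum.inl (x, j)) : ℕ) = j + d * x := by
  simp [eV]

/-- The number of the `j`-th fresh variable of the `i`-th listed constraint is
`n d + Σ_{i'<i} e_{s_{i'}} + j`. [folklore] -/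
theorem val_eV_inr (C : List (PPPower.Con br n)) (i : Fin C.length) (j : Fin (P.nEx (C.get i).1)) :
    (eV P C (Sum.inr ⟨i, j⟩) : ℕ) = n * d + (∑ i' : Fin i, P.nEx (C.get (Fin.castLE i.2.le i')).1 + j) := by
  simp [eV, finSigmaFinEquiv_apply]

/-- `esN` at the code of a constraint is the typed number of `∃`-variables. [folklore] -/
theorem esN_conCode (c : PPPower.Con br n) : esN P (conCode c).1 = P.nEx c.1 := by
  rw [conCode, esN, dif_pos c.1.2]

/-- `preN` at the code of the list is the typed prefix sum. [folklore] -/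
theorem preN_map_conCode (C : List (PPPower.Con br n)) {i : ℕ} (hi : i ≤ C.length) :
    preN P (C.map conCode) i = ∑ i' : Fin i, P.nEx (C.get (Fin.castLE hi i')).1 := by
  rw [preN, ← List.map_take, List.map_map, ← sum_map_take_eq C (fun c => P.nEx c.1) hi]
  congr 1
  refine List.map_congr_left fun c _ => ?_
  exact esN_conCode P c

/-- `nvarN` at the code of the list is `Nv`. [folklore] -/
theorem nvarN_map_conCode (C : List (PPPower.Con br n)) : nvarN P n (C.map conCode) = Nv P C := by
  rw [nvarN_eq, List.length_map, preN_map_conCode P C le_rfl]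
  rfl

/-- **Placements agree**: the number of the placed variable `p` of gadget `i` is `locN` at the code
of the constraint and the start `n d + preN i` of its block. [folklore] -/
theorem val_eV_sysLoc (C : List (PPPower.Con br n)) (i : Fin C.length)
    (p : Fin (br.get (C.get i).1 * d + P.nEx (C.get i).1)) :
    (eV P C (P.sysLoc C i p) : ℕ) =
      locN br d n (conCode (C.get i)) (n * d + preN P (C.map conCode) i) p := by
  have hk : br.getD (conCode (C.get i)).1 0 = br.get (C.get i).1 := by
    rw [conCode, List.getD_eq_getElem _ _ (C.get i).1.2]; rfl
  refine Fin.addCases (fun q => ?_) (fun j => ?_) p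
  · -- a free variable: copy `q % d` of element `v (q / d)`
    have hq : ((Fin.castAdd (P.nEx (C.get i).1) q : Fin (br.get (C.get i).1 * d + P.nEx (C.get i).1)) : ℕ) = q :=
      rfl
    rw [PPPower.sysLoc, Fin.append_left, locN, hk, hq, if_pos q.2]
    show ((eV P C (Sum.inl ((C.get i).2 q.divNat, q.modNat)) : ℕ)) = _
    rw [val_eV_inl]
    have hv : (((C.get i).2 q.divNat : Fin n) : ℕ) =
        (finFunctionFinEquiv (C.get i).2 : ℕ) / n ^ ((q : ℕ) / d) % n := by
      conv_lhs => rw [← finFunctionFinEquiv.symm_apply_apply (C.get i).2]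
      rw [finFunctionFinEquiv_symm_apply_val]
      rfl
    rw [hv]
    rfl
  · -- a quantified variable: the `j`-th fresh variable of block `i`
    have hj : ((Fin.natAdd (br.get (C.get i).1 * d) j : Fin (br.get (C.get i).1 * d + P.nEx (C.get i).1)) : ℕ) =
        br.get (C.get i).1 * d + j := rfl
    rw [PPPower.sysLoc, Fin.append_right, val_eV_inr, locN, hk, hj,
      if_neg (Nat.not_lt.2 (Nat.le_add_right _ _)), preN_map_conCode P C i.2.le, Nat.add_sub_cancel_left,
      Nat.add_assoc]

/-! ### Edges and representatives -/

/-- The typed EDGE LIST of the gadget system, in the order the machine lists it. [folklore] -/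
def edgeList (C : List (PPPower.Con br n)) : List (P.SysVar C × P.SysVar C) :=
  (List.finRange C.length).flatMap fun i =>
    (P.fmla (C.get i).1).eqs.map fun e => (P.sysLoc C i e.1, P.sysLoc C i e.2)

/-- `SysEdge` is membership in the edge list. [folklore] -/
theorem sysEdge_iff_mem_edgeList (C : List (PPPower.Con br n)) (a b : P.SysVar C) :
    P.SysEdge C a b ↔ (a, b) ∈ edgeList P C := by
  simp only [PPPower.SysEdge, edgeList, List.mem_flatMap, List.mem_finRange, true_and, List.mem_map,
    Prod.mk.injEq]

/-- `eqsN` at the code of a constraint lists the typed equality atoms by value. [folklore] -/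
theorem eqsN_conCode (c : PPPower.Con br n) :
    eqsN P (conCode c).1 = (P.fmla c.1).eqs.map fun e => ((e.1 : ℕ), (e.2 : ℕ)) := by
  rw [conCode, eqsN, dif_pos c.1.2]

/-- **Edges agree**: the numeric edge list is the typed one numbered by `eV`. [folklore] -/
theorem edgesN_eq_map (C : List (PPPower.Con br n)) :
    edgesN P n (C.map conCode) = (edgeList P C).map fun ab => ((eV P C ab.1 : ℕ), (eV P C ab.2 : ℕ)) := by
  rw [edgesN, zip_range_map, List.flatMap_map, edgeList, List.map_flatMap]
  congr 1
  funext i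
  rw [List.map_map, eqsN_conCode, List.map_map]
  refine List.map_congr_left fun e _ => ?_
  simp only [Function.comp_apply, val_eV_sysLoc]

/-- Every numeric edge joins numbers below `N'`. [folklore] -/
theorem edgesN_lt (C : List (PPPower.Con br n)) :
    ∀ e ∈ edgesN P n (C.map conCode), e.1 < Nv P C ∧ e.2 < Nv P C := by
  intro e he
  rw [edgesN_eq_map] at he
  obtain ⟨ab, -, rfl⟩ := List.mem_map.1 he
  exact ⟨Fin.is_lt _, Fin.is_lt _⟩

/-- **THE REPRESENTATIVES**: every variable goes to the variable numbered by the least element of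
its class. [folklore] -/
noncomputable def repV (C : List (PPPower.Con br n)) (u : P.SysVar C) : P.SysVar C :=
  (eV P C).symm ⟨MinLabel.classMin (edgesN P n (C.map conCode)) (eV P C u),
    MinLabel.classMin_lt _ (edgesN_lt P C) (Fin.is_lt _)⟩

/-- The number of the representative is the least element of the class. [folklore] -/
@[simp] theorem val_eV_repV (C : List (PPPower.Con br n)) (u : P.SysVar C) :
    (eV P C (repV P C u) : ℕ) = MinLabel.classMin (edgesN P n (C.map conCode)) (eV P C u) := by
  simp [repV]

/-- `repV` identifies the two sides of every edge. [folklore] -/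
theorem repV_eq_of_sysEdge (C : List (PPPower.Con br n)) (a b : P.SysVar C) (h : P.SysEdge C a b) :
    repV P C a = repV P C b := by
  apply (eV P C).injective
  apply Fin.ext
  rw [val_eV_repV, val_eV_repV]
  apply MinLabel.classMin_eq_of_mem
  rw [edgesN_eq_map]
  exact List.mem_map.2 ⟨(a, b), (sysEdge_iff_mem_edgeList P C a b).1 h, rfl⟩

/-- Classes of the numeric edges pull back to classes of `SysEdge` along the numbering. [folklore] -/
theorem eqvGen_sysEdge_of_eqvGen (C : List (PPPower.Con br n)) {x y : ℕ}
    (h : EqvGen (MinLabel.Adj (edgesN P n (C.map conCode))) x y) :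
    ∀ a b : P.SysVar C, (eV P C a : ℕ) = x → (eV P C b : ℕ) = y → EqvGen (P.SysEdge C) a b := by
  induction h with
  | rel x y hxy =>
    intro a b ha hb
    rw [MinLabel.Adj, edgesN_eq_map] at hxy
    obtain ⟨⟨a', b'⟩, hmem, he⟩ := List.mem_map.1 hxy
    simp only [Prod.mk.injEq] at he
    have ha' : a' = a := (eV P C).injective (Fin.ext (he.1.trans ha.symm))
    have hb' : b' = b := (eV P C).injective (Fin.ext (he.2.trans hb.symm))
    subst ha' hb'
    exact EqvGen.rel _ _ ((sysEdge_iff_mem_edgeList P C _ _).2 hmem)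
  | refl x =>
    intro a b ha hb
    have : a = b := (eV P C).injective (Fin.ext (ha.trans hb.symm))
    subst this
    exact EqvGen.refl _
  | symm x y _ ih =>
    intro a b ha hb
    exact EqvGen.symm _ _ (ih b a hb ha)
  | trans x m y h₁ _ ih₁ ih₂ =>
    intro a b ha hb
    rcases MinLabel.eq_or_lt_of_eqvGen _ (edgesN_lt P C) h₁ with rfl | ⟨-, hm⟩
    · exact ih₂ a b ha hb
    · let c : P.SysVar C := (eV P C).symm ⟨m, hm⟩
      have hc : (eV P C c : ℕ) = m := by simp [c]
      exact EqvGen.trans _ _ _ (ih₁ a c ha hc) (ih₂ c b hc hb)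

/-- `repV` moves every variable inside its class. [folklore] -/
theorem eqvGen_repV (C : List (PPPower.Con br n)) (u : P.SysVar C) : EqvGen (P.SysEdge C) (repV P C u) u :=
  eqvGen_sysEdge_of_eqvGen P C (MinLabel.eqvGen_classMin _ _) _ _ (val_eV_repV P C u) rfl

/-- THE LABELS: the least-label algorithm run on the numeric edges over the `N'` variables.
[folklore] -/
abbrev labels (C : List (PPPower.Con br n)) : List ℕ :=
  MinLabel.minLabels (edgesN P n (C.map conCode)) (Nv P C)

/-- **Labels agree**: the label computed for the number of `u` is the number of its representative.
[folklore] -/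
theorem getD_labels_eq (C : List (PPPower.Con br n)) (u : P.SysVar C) :
    (labels P C).getD (eV P C u) 0 = (eV P C (repV P C u) : ℕ) := by
  rw [MinLabel.getD_minLabels _ (edgesN_lt P C) (Fin.is_lt _), val_eV_repV]

/-- The label of a placed variable, read at its `locN` number. [folklore] -/
theorem getD_labels_locN (C : List (PPPower.Con br n)) (i : Fin C.length)
    (p : Fin (br.get (C.get i).1 * d + P.nEx (C.get i).1)) :
    (labels P C).getD (locN br d n (conCode (C.get i)) (n * d + preN P (C.map conCode) i) p) 0 =
      (eV P C (repV P C (P.sysLoc C i p)) : ℕ) := by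
  rw [← val_eV_sysLoc, getD_labels_eq]

/-! ### Facts and the output tables -/

/-- `relsN` at the code of a constraint lists the typed relational atoms by value. [folklore] -/
theorem relsN_conCode (c : PPPower.Con br n) :
    relsN P (conCode c).1 = (P.fmla c.1).rels.map fun a => ((a.2.1.1 : ℕ), List.ofFn fun j => (a.2.2 j : ℕ)) := by
  rw [conCode, relsN, dif_pos c.1.2]

/-- **Facts agree**: the numeric facts are the relational atoms of the listed constraints, placed,
moved to representatives and numbered. [folklore] -/
theorem factsN_eq (C : List (PPPower.Con br n)) :
    factsN P n (C.map conCode) (labels P C) =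
      (List.finRange C.length).flatMap fun i => (P.fmla (C.get i).1).rels.map fun a =>
        ((a.2.1.1 : ℕ), List.ofFn fun j => (eV P C (repV P C (P.sysLoc C i (a.2.2 j))) : ℕ)) := by
  rw [factsN, zip_range_map, List.flatMap_map]
  congr 1
  funext i
  rw [relsN_conCode, List.map_map]
  refine List.map_congr_left fun a _ => ?_
  simp only [Function.comp_apply, List.map_ofFn]
  refine Prod.ext rfl (congrArg List.ofFn (funext fun j => ?_))
  exact getD_labels_locN P C i (a.2.2 j)

/-- **The tuples of `sysStructure` are the numeric facts**: a tuple `w` over `Fin N'` lies in the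
relation `r` of the transported instance iff `(r, values of w)` is a fact. [folklore] -/
theorem relMap_sys_iff (C : List (PPPower.Con br n)) (r : Fin ar.length) (w : Fin (ar.get r) → Fin (Nv P C)) :
    @RelMap (relLanguage ar) (P.SysVar C) (P.sysStructure C (repV P C)) (ar.get r) ⟨r, rfl⟩ ((eV P C).symm ∘ w) ↔
      ((r : ℕ), List.ofFn fun j => (w j : ℕ)) ∈ factsN P n (C.map conCode) (labels P C) := by
  rw [factsN_eq]
  simp only [List.mem_flatMap, List.mem_finRange, true_and, List.mem_map]
  constructor
  · rintro ⟨i, z, hz, hw⟩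
    refine ⟨i, ⟨ar.get r, ⟨r, rfl⟩, z⟩, hz, Prod.ext rfl (congrArg List.ofFn (funext fun j => ?_))⟩
    have h := congrFun hw j
    simp only [Function.comp_apply] at h
    change ((eV P C (repV P C (P.sysLoc C i (z j))) : ℕ)) = (w j : ℕ)
    rw [← h, Equiv.apply_symm_apply]
  · rintro ⟨i, ⟨l, ⟨r', hr'⟩, z⟩, hz, h⟩
    simp only [Prod.mk.injEq] at h
    obtain ⟨h1, h2⟩ := h
    subst hr'
    have hr : r' = r := Fin.ext h1
    subst hr
    refine ⟨i, z, hz, funext fun j => ?_⟩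
    have hj := congrFun (List.ofFn_injective h2) j
    simp only [Function.comp_apply]
    rw [Equiv.symm_apply_eq]
    exact (Fin.ext hj).symm

/-- THE TABLES OF THE IMAGE INSTANCE: the tables of `sysStructure` transported to `Fin N'` along
`eV`. [cite: BartoOprsalPinsker2017, Prop. 3.1 (proof)] -/
noncomputable def outTables (C : List (PPPower.Con br n)) : RelTables ar (Nv P C) :=
  @tablesOfStructure ar (Nv P C)
    (@Equiv.inducedStructure (relLanguage ar) (P.SysVar C) (Fin (Nv P C)) (P.sysStructure C (repV P C)) (eV P C))

/-- The tables of the image instance, entry by entry, are the membership bits in the facts. [folklore] -/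
theorem outTables_apply (C : List (PPPower.Con br n)) (r : Fin ar.length) (w : Fin (ar.get r) → Fin (Nv P C)) :
    outTables P C r w = decide (((r : ℕ), List.ofFn fun j => (w j : ℕ)) ∈ factsN P n (C.map conCode) (labels P C)) := by
  unfold outTables tablesOfStructure
  exact (decide_eq_decide).2 (relMap_sys_iff P C r w)

/-- **The output string is the table string of the image instance.** [folklore] -/
theorem bitsN_eq_tableString (C : List (PPPower.Con br n)) :
    bitsN ar (Nv P C) (factsN P n (C.map conCode) (labels P C)) = tableString (outTables P C) := by
  rw [tableString, ofFn_relTablesEquiv_eq_flatMap, bitsN, ← List.map_coe_finRange_eq_range, List.flatMap_map]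
  congr 1
  funext r
  rw [bitsAt, List.getD_eq_getElem _ _ r.2, List.ofFn_eq_map, ← List.map_coe_finRange_eq_range, List.map_map]
  change ((List.finRange (Nv P C ^ ar.get r)).map _) = _
  refine List.map_congr_left fun t _ => ?_
  rw [Function.comp_apply, outTables_apply]
  congr 2
  refine Prod.ext rfl ?_
  change digits (Nv P C) (ar.get r) t = List.ofFn fun j => ((finFunctionFinEquiv.symm t j : Fin (Nv P C)) : ℕ)
  rw [digits, ← ofFn_eq_map_range]
  rfl

/-- **Transport**: the image instance maps homomorphically to `T` iff `sysStructure` does (the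
bijection `eV` is an isomorphism onto the induced structure). [folklore] -/
theorem hasHomTo_outTables_iff (C : List (PPPower.Con br n)) {m : ℕ} (T : RelTables ar m) :
    HasHomTo (outTables P C) T ↔
      Nonempty (@FirstOrder.Language.Hom (relLanguage ar) (P.SysVar C) (Fin m) (P.sysStructure C (repV P C))
        (structureOfTables T)) := by
  letI := structureOfTables T
  letI := P.sysStructure C (repV P C)
  unfold HasHomTo outTables
  rw [structureOfTables_tablesOfStructure]
  letI : (relLanguage ar).Structure (Fin (Nv P C)) := Equiv.inducedStructure (eV P C)
  let e := Equiv.inducedStructureEquiv (L := relLanguage ar) (eV P C)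
  exact ⟨fun ⟨g⟩ => ⟨g.comp e.toHom⟩, fun ⟨g⟩ => ⟨g.comp e.symm.toHom⟩⟩

/-! ### The reduction -/

/-- THE OUTPUT STRING on a parsed instance `(n, table string)`: constraints, number of variables,
edges, labels, facts, tabulation, and the code `⟨N', tables⟩`. [cite: BartoOprsalPinsker2017, Prop. 3.1 (proof)] -/
def outStr (n : ℕ) (body : List Bool) : List Bool :=
  boolPair (encodeNat (nvarN P n (conNum br n body)))
    (bitsN ar (nvarN P n (conNum br n body))
      (factsN P n (conNum br n body)
        (MinLabel.minLabels (edgesN P n (conNum br n body)) (nvarN P n (conNum br n body)))))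

/-- **THE REDUCTION `CSP(T') → CSP(T)` ON STRINGS**: the output string of the parsed instance on
well-formed instance codes, the non-code `ε` elsewhere. [cite: BartoOprsalPinsker2017, Cor. 3.5] -/
def redFn (w : List Bool) : List Bool :=
  if instOK br w then outStr P (min (bitsToNat (fstF w)) (sndF w).length) (sndF w) else []

/-- The stages of `outStr` on codes: constraints, sizes, edges, labels, facts, bits (record
`(1ⁿ, body)`). [cite: AroraBarak2009, §1.3] -/
theorem codeFP_outStages :
    CodeFP (pairE unE strE) (pairE natE strE) (fun p =>
      (nvarN P p.1 (conNum br p.1 p.2),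
        bitsN ar (nvarN P p.1 (conNum br p.1 p.2)) (factsN P p.1 (conNum br p.1 p.2)
          (MinLabel.minLabels (edgesN P p.1 (conNum br p.1 p.2)) (nvarN P p.1 (conNum br p.1 p.2)))))) := by
  let cE : ℕ × List Bool → List Bool := pairE unE strE
  have hnC : CodeFP cE (pairE unE (rawE (pairE natE natE))) (fun p => (p.1, conNum br p.1 p.2)) :=
    (fst _ _).pair codeFP_conNum
  have hNun : CodeFP cE unE (fun p => nvarN P p.1 (conNum br p.1 p.2)) := (codeFP_nvarN_un P).comp hnC
  have hN : CodeFP cE natE (fun p => nvarN P p.1 (conNum br p.1 p.2)) := (codeFP_nvarN P).comp hnC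
  -- (every composite is re-stated through `congr` + `dsimp only`, which reduces the projections of
  -- the intermediate pairs syntactically; leaving this to definitional unfolding is far too slow)
  have hE : CodeFP cE (rawE (pairE natE natE)) (fun p => edgesN P p.1 (conNum br p.1 p.2)) :=
    ((codeFP_edgesN P).comp hnC).congr fun p => by dsimp only
  have hLab : CodeFP cE (rawE natE) (fun p =>
      MinLabel.minLabels (edgesN P p.1 (conNum br p.1 p.2)) (nvarN P p.1 (conNum br p.1 p.2))) :=
    (MinLabel.codeFP_minLabels.comp (hE.pair hNun)).congr fun p => by dsimp only
  have hF : CodeFP cE (rawE (pairE natE (rawE natE))) (fun p => factsN P p.1 (conNum br p.1 p.2)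
      (MinLabel.minLabels (edgesN P p.1 (conNum br p.1 p.2)) (nvarN P p.1 (conNum br p.1 p.2)))) :=
    ((codeFP_factsN P).comp (hLab.pair hnC)).congr fun p => by dsimp only
  have hbits : CodeFP cE strE (fun p => bitsN ar (nvarN P p.1 (conNum br p.1 p.2)) (factsN P p.1 (conNum br p.1 p.2)
      (MinLabel.minLabels (edgesN P p.1 (conNum br p.1 p.2)) (nvarN P p.1 (conNum br p.1 p.2))))) :=
    (codeFP_bitsN.comp (hNun.pair hF)).congr fun p => by dsimp only
  exact hN.pair hbits

/-- `outStr` is computed on codes (`n` in unary). [cite: AroraBarak2009, §1.3] -/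
theorem codeFP_outStr : CodeFP (pairE unE strE) strE (fun p => outStr P p.1 p.2) := by
  obtain ⟨f, hf, hfg⟩ := codeFP_outStages P
  refine ⟨f, hf, fun p => ?_⟩
  rw [hfg p]
  simp only [outStr, pairE_apply]
  rfl

/-- `redFn` is computed on codes. [cite: AroraBarak2009, §1.3] -/
theorem codeFP_redFn : CodeFP strE strE (redFn P) := by
  have hn : CodeFP strE unE (fun w => min (bitsToNat (fstF w)) (sndF w).length) :=
    (unOfNatMin.comp ((strLength.comp codeFP_hdrBody.snd').pair codeFP_hdrBody.fst')).congr fun w => by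
      dsimp only
  have hout : CodeFP strE strE (fun w => outStr P (min (bitsToNat (fstF w)) (sndF w).length) (sndF w)) :=
    ((codeFP_outStr P).comp (hn.pair codeFP_hdrBody.snd')).congr fun w => by dsimp only
  exact (codeFP_instOK.ite hout (const strE ([] : List Bool))).congr fun w => by rw [redFn]

/-- **The reduction is polynomial time.** [cite: AroraBarak2009, §1.3] -/
theorem redFn_mem_FP : redFn P ∈ FP := by
  obtain ⟨f, hf, hfg⟩ := codeFP_redFn P
  have : f = redFn P := funext fun w => hfg w
  rw [← this]
  exact hf

/-- Instance codes pass the well-formedness test. [folklore] -/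
theorem instOK_encode (x : SNPInstance br) : instOK br ((encodingSNPInstance br).encode x) = true := by
  rw [encode_eq, instOK, fstF_boolPair, sndF_boolPair, bitsToNat_encodeNat, Bool.and_eq_true, decide_eq_true_eq,
    decide_eq_true_eq]
  exact ⟨rfl, by rw [length_tableString, blockOff_length]⟩

/-- `List.ofFn` of the entries of a list along a cast of its length is the list. [folklore] -/
theorem ofFn_get_cast {α : Type*} {k : ℕ} (l : List α) (h : k = l.length) :
    List.ofFn (fun i : Fin k => l.get (i.cast h)) = l := by
  subst h
  exact List.ofFn_get l

/-- **A string passing the well-formedness test is an instance code.** [folklore] -/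
theorem exists_encode_of_instOK {w : List Bool} (h : instOK br w = true) :
    ∃ x : SNPInstance br, (encodingSNPInstance br).encode x = w := by
  rw [instOK, Bool.and_eq_true, decide_eq_true_eq, decide_eq_true_eq] at h
  obtain ⟨hw, hlen⟩ := h
  set nn := bitsToNat (fstF w) with hnn
  have hlen' : tableBits br nn = (sndF w).length := by rw [← blockOff_length, hlen]
  let v : Fin (tableBits br nn) → Bool := fun i => (sndF w).get (i.cast hlen')
  refine ⟨⟨nn, (relTablesEquiv br nn).symm v⟩, ?_⟩
  rw [encode_eq]
  change boolPair (encodeNat nn) (List.ofFn ((relTablesEquiv br nn) ((relTablesEquiv br nn).symm v))) = w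
  rw [Equiv.apply_symm_apply]
  conv_rhs => rw [← hw]
  congr 1
  exact ofFn_get_cast (sndF w) hlen'

/-- **The reduction on an instance code is the code of the image instance** (non-degenerate
instance vocabulary: the table string has at least `n` bits, so the capped unary universe size
read off the code is `n`). [cite: BartoOprsalPinsker2017, Prop. 3.1 (proof)] -/
theorem redFn_encode (hbr : IsNondegenerateVocab br) (x : SNPInstance br) :
    redFn P ((encodingSNPInstance br).encode x) =
      (encodingSNPInstance ar).encode ⟨Nv P (PPPower.conList x.2), outTables P (PPPower.conList x.2)⟩ := by
  obtain ⟨n, R⟩ := x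
  rw [redFn, if_pos (instOK_encode _), encode_eq, fstF_boolPair, sndF_boolPair, bitsToNat_encodeNat,
    length_tableString, min_eq_left (le_tableBits_of_isNondegenerateVocab hbr n), outStr, conNum_tableString,
    nvarN_map_conCode, bitsN_eq_tableString, encode_eq]

/-- Instance codes are non-empty strings. [folklore] -/
theorem encode_ne_nil (x : SNPInstance ar) : (encodingSNPInstance ar).encode x ≠ [] := by
  intro h
  have := congrArg List.length h
  rw [encode_eq, length_boolPair, List.length_nil] at this
  omega

end GadgetCode

/-! ### The theorem -/

open GadgetCode in
/-- **Discharge of `cspLanguage_karpReducible_of_ppConstructs`** (Barto–Opršal–Pinsker, Cor. 3.5 with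
Cor. 3.10, Prop. 3.1 (Bulatov–Jeavons–Krokhin) and Prop. 3.2; polynomial-time form, finite templates,
non-degenerate instance vocabulary). If `T` pp-constructs `T'`, i.e. `T'` is homomorphically
equivalent to a pp-power `P` of `T`, then `cspLanguage T' ≤ₚ cspLanguage T` by the string function
`redFn P` (`redFn_mem_FP`): on the code of an instance `⟨n, R⟩` it is the code of the image
instance (`redFn_encode`), which maps homomorphically to `T` iff the instance on the variables does
(`hasHomTo_outTables_iff`) iff `⟨n, R⟩` maps homomorphically to the pp-power
(`PPPower.nonempty_sysHom_iff`) iff to `T'` (`HomEquivalent.nonempty_hom_iff`); every other string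
is sent to `ε`, which is no code. [cite: BartoOprsalPinsker2017, Cor. 3.5 with Cor. 3.10 and Prop. 3.1] -/
theorem cspLanguage_karpReducible_of_ppConstructs_holds : cspLanguage_karpReducible_of_ppConstructs := by
  intro ar br m m' T T' hbr hpp
  letI iT := structureOfTables T
  letI iT' := structureOfTables T'
  obtain ⟨d, -, P, hhe⟩ := hpp
  refine ⟨redFn P, redFn_mem_FP P, fun w => ?_⟩
  by_cases hw : instOK br w = true
  · obtain ⟨⟨n, R⟩, rfl⟩ := exists_encode_of_instOK hw
    rw [redFn_encode P hbr]
    refine (encode_mem_cspLanguage_iff T' ⟨n, R⟩).trans (Iff.trans ?_ (encode_mem_cspLanguage_iff T _).symm)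
    show HasHomTo R T' ↔ HasHomTo (outTables P (PPPower.conList R)) T
    rw [hasHomTo_outTables_iff]
    letI iR := structureOfTables R
    rw [HasHomTo, hhe.nonempty_hom_iff (Fin n)]
    exact (P.nonempty_sysHom_iff (PPPower.conList R) (repV P _) R (PPPower.mem_conList_iff R)
      (repV_eq_of_sysEdge P _) (eqvGen_repV P _)).symm
  · rw [redFn, if_neg hw]
    constructor
    · intro h
      obtain ⟨x, -, hx⟩ := (Set.mem_image _ _ _).1 h
      exact absurd (hx ▸ instOK_encode x) hw
    · intro h
      obtain ⟨x, -, hx⟩ := (Set.mem_image _ _ _).1 h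
      exact absurd hx (encode_ne_nil x)

end Literature.ModelTheory.FiniteModelTheory
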